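import Summits.Parity.BatemanHorn.Theorems.SoloInformedThinRows
import HarnessLib

/-!
# Thin sequences vs. Type-I/II information, XVI: Type II against column-sparse comparisons

A sharper Type-II void theorem.  In `SoloInformedThinComparison` / `SoloInformedThinLocal` the
cofactors `n` whose column `{pn : p ∈ S}` meets the support of `a` were removed at a cost of
`#S · x^η` each (height bound `b ≤ x^η`), which forced the coupling `θ + η < c`.  Charging
instead the actual column mass `∑_{p} b(pn) ≤ x^σ` of the removed cofactors decouples the two:
if `b ≥ 0` has columns of mass `≤ x^σ` over the primes `(x/2)^θ < p ≤ x^κ` (`σ < c`) and puts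
mass `≥ x/(4p)` on the multiples of the primes `p ∉ Q` of that range (`κ > θ`, `#Q ≤ (log x)²`),
then for every real `a` with at most `x^{1−c}` non-zero values on `(x/2, x]`, `w = a − b`
violates (II) in every window `[θ, θ + ν]` with `θ < c` — no height condition.  For
Ford–Maynard's short-interval sequences `x/(2y)·1_{(x−y,x]}` the columns have mass
`≤ x^κ + x/(2y)`, whence the decoupled conditions `θ < c`, `y ≥ x^{1−c+ε}`
(`SoloInformedThinSharp`).

* `typeII_sparse_le_col` — the explicit inequality
  `∑_{p∈S} ∑_n b(pn) − Λ · #A · log x/log M ≤ x/(log x)^B` (`Λ` = column bound);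
* `rpow_mul_log_le_div`, `div_log_le_card_mul_div` — real bookkeeping;
* `eventually_not_typeII_of_sparse_col`, `eventually_not_typeII_of_sparse_col_coprime`.

References: [cite: FordMaynard2024PrimeSieves, §2.4] [cite: FordMaynard2024PrimeSieves, §1 (II)]
[cite: FordMaynard2024PrimeSieves, §4.2 (Lemma 4.6)].
-/

noncomputable section

open Filter Finset Real

namespace Summit.Parity.BatemanHorn.Theorems

open Literature.Barriers.Parity.FordMaynard (TypeII eventually_mul_rpow_le_rpow)

/-- **(II) against a thin support, column-sparse comparison.**  Let `S` be a finite set of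
primes `p > M` inside the Type-II window, `A ⊇` the support of `a` on `(x/2, x]`, `b ≥ 0` with
columns `∑_{p ∈ S, x/2 < pn ≤ x} b(pn) ≤ Λ` for every `n`.  If `w = a − b` satisfies (II), then
`∑_{p ∈ S} ∑_{x/2 < pn ≤ x} b(pn) − Λ · (#A · log x / log M) ≤ x/(log x)^B`.
[cite: FordMaynard2024PrimeSieves, §2.4] -/
theorem typeII_sparse_le_col {a b : ℕ → ℝ} {x θ ν B Λ : ℝ} (hB : 0 ≤ B) (hx : 1 ≤ x) {M : ℝ}
    (hM : 1 < M) (S A : Finset ℕ)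
    (hS : ∀ p ∈ S, p.Prime ∧ M < (p : ℝ) ∧ (x / 2) ^ θ < (p : ℝ) ∧ (p : ℝ) ≤ x ^ (θ + ν))
    (hA : ∀ v : ℕ, x / 2 < (v : ℝ) → (v : ℝ) ≤ x → a v ≠ 0 → v ∈ A)
    (hb0 : ∀ n, 0 ≤ b n)
    (hcol : ∀ n : ℕ, ∑ p ∈ S.filter
        (fun p : ℕ => x / 2 < (p * n : ℝ) ∧ (p * n : ℝ) ≤ x), b (p * n) ≤ Λ)
    (h : TypeII (fun n : ℕ => a n - b n) x θ ν B) :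
    ∑ p ∈ S, ∑ n ∈ (Icc 1 ⌊x⌋₊).filter
        (fun n : ℕ => x / 2 < (p * n : ℝ) ∧ (p * n : ℝ) ≤ x), b (p * n)
      - Λ * (A.card * (Real.log x / Real.log M))
      ≤ x / Real.log x ^ B := by
  have hΛ : 0 ≤ Λ := le_trans (sum_nonneg fun _ _ => hb0 _) (hcol 0)
  set L := Real.log x / Real.log M with hL
  set W : Finset ℕ :=
    (Icc 1 ⌊x ^ (θ + ν)⌋₊).filter (fun m : ℕ => (x / 2) ^ θ < (m : ℝ)) with hW
  set Nw : ℕ → Finset ℕ := fun m : ℕ =>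
    (Icc 1 ⌊x⌋₊).filter (fun n : ℕ => x / 2 < (m * n : ℝ) ∧ (m * n : ℝ) ≤ x) with hNw
  -- (II) tested against `ξ = 1_S`, `κ = 1_{good cofactors}`
  have hT : ∑ m ∈ W, ∑ n ∈ (Nw m).filter (fun n : ℕ => m ∈ S ∧
      ∀ q ∈ S, x / 2 < (q * n : ℝ) → (q * n : ℝ) ≤ x → a (q * n) = 0), b (m * n) ≤
      x / Real.log x ^ B :=
    typeII_zero_pairs_sum_le hB (fun m : ℕ => m ∈ S)
      (fun n : ℕ => ∀ q ∈ S, x / 2 < (q * n : ℝ) → (q * n : ℝ) ≤ x → a (q * n) = 0) hb0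
      (fun m n hm hn h1 h2 => hn m hm h1 h2) h
  have hS' : ∀ p ∈ S, p.Prime ∧ M < (p : ℝ) := fun p hp => ⟨(hS p hp).1, (hS p hp).2.1⟩
  have hSW : S ⊆ W := by
    intro p hp
    obtain ⟨hpr, _, h1, h2⟩ := hS p hp
    rw [hW, Finset.mem_filter, mem_Icc]
    exact ⟨⟨hpr.one_le, Nat.le_floor h2⟩, h1⟩
  -- the bad cofactors
  set E : Finset ℕ := (Icc 1 ⌊x⌋₊).filter (fun r : ℕ => ∃ p : ℕ, p ∈ S ∧
      (x / 2 < (p * r : ℝ) ∧ (p * r : ℝ) ≤ x) ∧ a (p * r) ≠ 0) with hE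
  have hEcard : (E.card : ℝ) ≤ A.card * L :=
    card_badCofactors_le hx hM S A E hS' hA (fun r hr => by
      have hr' := hr
      simp only [hE, Finset.mem_filter] at hr'
      exact hr'.2)
  -- per prime: the bad cofactors of `Nw p` lie in `E ∩ {x/2 < pn ≤ x}`
  have hsub2 : ∀ p ∈ S, (Nw p).filter (fun n : ℕ => ¬ (p ∈ S ∧
      ∀ q ∈ S, x / 2 < (q * n : ℝ) → (q * n : ℝ) ≤ x → a (q * n) = 0)) ⊆
      E.filter (fun n : ℕ => x / 2 < (p * n : ℝ) ∧ (p * n : ℝ) ≤ x) := by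
    intro p hp n hn
    rw [Finset.mem_filter] at hn
    obtain ⟨hnN, hneg⟩ := hn
    have hnN' := hnN
    simp only [hNw, Finset.mem_filter] at hnN'
    rw [Finset.mem_filter]
    refine ⟨?_, hnN'.2⟩
    simp only [hE, Finset.mem_filter]
    refine ⟨hnN'.1, ?_⟩
    by_contra hno
    apply hneg
    refine ⟨hp, fun q hq h1 h2 => ?_⟩
    by_contra hne
    exact hno ⟨q, hq, ⟨h1, h2⟩, hne⟩
  -- total = good + bad
  have hsplit : ∑ p ∈ S, ∑ n ∈ Nw p, b (p * n) =
      ∑ p ∈ S, ∑ n ∈ (Nw p).filter (fun n : ℕ => p ∈ S ∧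
        ∀ q ∈ S, x / 2 < (q * n : ℝ) → (q * n : ℝ) ≤ x → a (q * n) = 0), b (p * n) +
      ∑ p ∈ S, ∑ n ∈ (Nw p).filter (fun n : ℕ => ¬ (p ∈ S ∧
        ∀ q ∈ S, x / 2 < (q * n : ℝ) → (q * n : ℝ) ≤ x → a (q * n) = 0)), b (p * n) := by
    rw [← sum_add_distrib]
    refine sum_congr rfl fun p _ => ?_
    rw [sum_filter_add_sum_filter_not]
  have hgood : ∑ p ∈ S, ∑ n ∈ (Nw p).filter (fun n : ℕ => p ∈ S ∧
        ∀ q ∈ S, x / 2 < (q * n : ℝ) → (q * n : ℝ) ≤ x → a (q * n) = 0), b (p * n) ≤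
      x / Real.log x ^ B :=
    (sum_le_sum_of_subset_of_nonneg hSW (fun _ _ _ => sum_nonneg fun _ _ => hb0 _)).trans hT
  have hbad1 : ∑ p ∈ S, ∑ n ∈ (Nw p).filter (fun n : ℕ => ¬ (p ∈ S ∧
        ∀ q ∈ S, x / 2 < (q * n : ℝ) → (q * n : ℝ) ≤ x → a (q * n) = 0)), b (p * n) ≤
      ∑ p ∈ S, ∑ n ∈ E.filter (fun n : ℕ => x / 2 < (p * n : ℝ) ∧ (p * n : ℝ) ≤ x),
        b (p * n) :=
    sum_le_sum fun p hp => sum_le_sum_of_subset_of_nonneg (hsub2 p hp) (fun _ _ _ => hb0 _)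
  have hswap : ∑ p ∈ S, ∑ n ∈ E.filter (fun n : ℕ => x / 2 < (p * n : ℝ) ∧ (p * n : ℝ) ≤ x),
        b (p * n) =
      ∑ n ∈ E, ∑ p ∈ S.filter (fun p : ℕ => x / 2 < (p * n : ℝ) ∧ (p * n : ℝ) ≤ x),
        b (p * n) := by
    refine Finset.sum_comm' ?_
    intro p n
    simp only [Finset.mem_filter]
    tauto
  have hbad2 : ∑ n ∈ E, ∑ p ∈ S.filter (fun p : ℕ => x / 2 < (p * n : ℝ) ∧ (p * n : ℝ) ≤ x),
        b (p * n) ≤ E.card * Λ := by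
    rw [← nsmul_eq_mul, ← sum_const]
    exact sum_le_sum fun n _ => hcol n
  have hbad3 : (E.card : ℝ) * Λ ≤ Λ * (A.card * L) := by
    rw [mul_comm]
    exact mul_le_mul_of_nonneg_left hEcard hΛ
  rw [hswap] at hbad1
  linarith

/-- Bookkeeping for the removed columns: `x^α · x^β · 2 log x ≤ x/(64 K log x)` once
`log x ≤ x^δ` and `128 K x^{α+β+2δ} ≤ x`. [folklore] -/
theorem rpow_mul_log_le_div {x K α β δ : ℝ} (hx : 0 < x) (hK : 0 < K) (hl : 0 < Real.log x)
    (hlog : Real.log x ≤ x ^ δ) (he : 128 * K * x ^ (α + β + δ + δ) ≤ x) :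
    x ^ α * (x ^ β * (2 * Real.log x)) ≤ x / (8 * (4 * K) * Real.log x) / 2 := by
  rw [le_div_iff₀ (by norm_num : (0 : ℝ) < 2), le_div_iff₀ (by positivity)]
  have hl2 : Real.log x * Real.log x ≤ x ^ δ * x ^ δ :=
    mul_le_mul hlog hlog hl.le (Real.rpow_nonneg hx.le _)
  have hprod : x ^ α * x ^ β * x ^ δ * x ^ δ = x ^ (α + β + δ + δ) := by
    rw [← Real.rpow_add hx, ← Real.rpow_add hx, ← Real.rpow_add hx]
  have hnn : 0 ≤ x ^ α * x ^ β := by positivity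
  calc x ^ α * (x ^ β * (2 * Real.log x)) * 2 * (8 * (4 * K) * Real.log x)
        = 128 * K * (x ^ α * x ^ β * (Real.log x * Real.log x)) := by ring
    _ ≤ 128 * K * (x ^ α * x ^ β * (x ^ δ * x ^ δ)) :=
        mul_le_mul_of_nonneg_left (mul_le_mul_of_nonneg_left hl2 hnn) (by positivity)
    _ = 128 * K * x ^ (α + β + δ + δ) := by rw [← hprod]; ring
    _ ≤ x := he

/-- Bookkeeping for the main term: from `#S ≥ M/(2K log 2M)` and `log 2M ≤ log x`,
`#S · x/(16M) ≥ x/(32 K log x)` (and `#S · x/(8M)` is twice `#S · x/(16M)`). [folklore] -/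
theorem div_log_le_card_mul_div {x K M s : ℝ} (hx : 0 < x) (hK : 0 < K) (hM : 0 < M)
    (hlx : 0 < Real.log x) (hl0 : 0 < Real.log (2 * M)) (hl : Real.log (2 * M) ≤ Real.log x)
    (hs : M / (2 * K * Real.log (2 * M)) ≤ s) :
    x / (8 * (4 * K) * Real.log x) ≤ s * (x / (16 * M)) ∧
      s * (x / (8 * M)) = 2 * (s * (x / (16 * M))) := by
  have hMK : M / (2 * K * Real.log x) ≤ s :=
    le_trans (div_le_div_of_nonneg_left hM.le (by positivity)
      (mul_le_mul_of_nonneg_left hl (by positivity))) hs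
  have hMne : M ≠ 0 := hM.ne'
  have hlxne : Real.log x ≠ 0 := hlx.ne'
  have hKne : K ≠ 0 := hK.ne'
  constructor
  · calc x / (8 * (4 * K) * Real.log x)
          = M / (2 * K * Real.log x) * (x / (16 * M)) := by
          field_simp
          try ring
      _ ≤ s * (x / (16 * M)) := mul_le_mul_of_nonneg_right hMK (by positivity)
  · field_simp
    ring

set_option maxHeartbeats 400000 in
/-- **No Type-II information below the density — column-sparse comparison, no height
condition.**  Let `0 ≤ θ < κ`, `θ < c ≤ 1`, `σ < c`, `ν > 0`, `B > 1`.  For all large `x`: for no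
real `a` with at most `x^{1−c}` non-zero values on `(x/2, x]`, no exceptional set `Q` of at most
`(log x)²` primes and no `b ≥ 0` with columns `∑_{(x/2)^θ < p ≤ x^κ, x/2 < pn ≤ x} b(pn) ≤ x^σ`
(`p` prime, every `n`) and mass `∑_{x/2 < pn ≤ x} b(pn) ≥ x/(4p)` for every prime
`(x/2)^θ < p ≤ x^κ`, `p ∉ Q`, does `w = a − b` satisfy (II) in `[θ, θ + ν]`.
[cite: FordMaynard2024PrimeSieves, §2.4] [cite: FordMaynard2024PrimeSieves, §4.2 (Lemma 4.6)] -/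
theorem eventually_not_typeII_of_sparse_col {c θ ν B σ κ : ℝ} (hθ : 0 ≤ θ) (hθc : θ < c)
    (hc1 : c ≤ 1) (hσ : σ < c) (hν : 0 < ν) (hB : 1 < B) (hκ : θ < κ) :
    ∀ᶠ x : ℝ in atTop, ∀ (a b : ℕ → ℝ) (A Q : Finset ℕ), (A.card : ℝ) ≤ x ^ (1 - c) →
      (∀ v : ℕ, x / 2 < (v : ℝ) → (v : ℝ) ≤ x → a v ≠ 0 → v ∈ A) →
      (∀ n, 0 ≤ b n) → (Q.card : ℝ) ≤ Real.log x ^ 2 →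
      (∀ n : ℕ, ∑ p ∈ (Icc 1 ⌊x ^ κ⌋₊).filter (fun p : ℕ => p.Prime ∧
          (x / 2) ^ θ < (p : ℝ) ∧ (x / 2 < (p * n : ℝ) ∧ (p * n : ℝ) ≤ x)), b (p * n)
        ≤ x ^ σ) →
      (∀ p : ℕ, p.Prime → p ∉ Q → (x / 2) ^ θ < (p : ℝ) → (p : ℝ) ≤ x ^ κ →
        x / (4 * p) ≤ ∑ n ∈ (Icc 1 ⌊x⌋₊).filter
          (fun n : ℕ => x / 2 < (p * n : ℝ) ∧ (p * n : ℝ) ≤ x), b (p * n)) →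
      ¬ TypeII (fun n : ℕ => a n - b n) x θ ν B := by
  obtain ⟨K, hK1, hK⟩ := exists_card_primes_Ioc_two_mul_ge
  have hK0 : 0 < K := by linarith
  -- an exponent `θ'` strictly inside the window with `θ' < c`, `0 < θ' < κ`
  set μ : ℝ := min (min ν (c - θ)) (κ - θ) with hμdef
  have hμν : μ ≤ ν := (min_le_left _ _).trans (min_le_left _ _)
  have hμc : μ ≤ c - θ := (min_le_left _ _).trans (min_le_right _ _)
  have hμκ : μ ≤ κ - θ := min_le_right _ _
  have hμ0 : 0 < μ := lt_min (lt_min hν (by linarith)) (by linarith)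
  set θ' : ℝ := θ + μ / 2 with hθ'def
  have hθθ' : θ ≤ θ' := by rw [hθ'def]; linarith
  have hθ'0 : 0 < θ' := by rw [hθ'def]; linarith
  have hθ'ν : θ' < θ + ν := by rw [hθ'def]; linarith
  have hθ'1 : θ' < 1 := by rw [hθ'def]; linarith
  have hθ'κ : θ' < κ := by rw [hθ'def]; linarith
  -- the column exponent: `max σ 0 < c`, `δ = (c − max σ 0)/3`
  have hs0 : (0 : ℝ) ≤ max σ 0 := le_max_right _ _
  have hsσ : σ ≤ max σ 0 := le_max_left _ _
  have hsc : max σ 0 < c := max_lt hσ (by linarith)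
  have hδ : 0 < (c - max σ 0) / 3 := by linarith
  have hθ'4 : 0 < θ' / 4 := by linarith
  filter_upwards [eventually_ge_atTop (4 : ℝ),
    eventually_mul_rpow_le_rpow 6 hθ'ν,
    eventually_mul_rpow_le_rpow 6 hθ'κ,
    eventually_mul_rpow_le_rpow 48 hθ'1,
    eventually_mul_rpow_le_rpow (128 * K)
      (by linarith : max σ 0 + (1 - c) + (c - max σ 0) / 3 + (c - max σ 0) / 3 < 1),
    (isLittleO_log_rpow_atTop hδ).bound one_pos,
    (isLittleO_log_rpow_atTop hθ'4).bound one_pos,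
    eventually_mul_rpow_le_rpow (4 * K) (by linarith : θ' / 4 + θ' / 4 + θ' / 4 < θ'),
    ((tendsto_rpow_atTop (by linarith : 0 < B - 1)).comp
      Real.tendsto_log_atTop).eventually_gt_atTop (8 * (4 * K))]
    with x hx4 e1 e1' e2 e3 elog elog2 e5 e4 a b A Q hA hcov hb0 hQ hcol hbm hII
  rw [Real.rpow_one] at e2 e3
  have hx0 : 0 < x := by linarith
  have hx1 : 1 ≤ x := by linarith
  have hlx : 0 ≤ Real.log x := Real.log_nonneg hx1
  have hlogle : Real.log x ≤ x ^ ((c - max σ 0) / 3) := by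
    have := elog
    simp only [one_mul, Real.norm_eq_abs] at this
    rwa [abs_of_nonneg hlx, abs_of_nonneg (Real.rpow_nonneg hx0.le _)] at this
  have hlogle2 : Real.log x ≤ x ^ (θ' / 4) := by
    have := elog2
    simp only [one_mul, Real.norm_eq_abs] at this
    rwa [abs_of_nonneg hlx, abs_of_nonneg (Real.rpow_nonneg hx0.le _)] at this
  have e4' : 8 * (4 * K) < Real.log x ^ (B - 1) := by simpa using e4
  -- the scale `M ≍ x^θ'` and the primes `S` of `(M, 2M]` outside `Q`
  set M : ℕ := ⌊x ^ θ'⌋₊ + 2 with hMdef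
  have hM2 : 2 ≤ M := by omega
  have hM2r : (2 : ℝ) ≤ M := by exact_mod_cast hM2
  have hMθ' : x ^ θ' < M := by
    have := Nat.lt_floor_add_one (x ^ θ')
    push_cast [hMdef]
    linarith
  have hMθ : (x / 2) ^ θ < M := by
    have h1 : (x / 2) ^ θ ≤ x ^ θ := Real.rpow_le_rpow (by linarith) (by linarith) hθ
    have h2 : x ^ θ ≤ x ^ θ' := Real.rpow_le_rpow_of_exponent_le hx1 hθθ'
    linarith
  have hxθ1 : 1 ≤ x ^ θ' := Real.one_le_rpow hx1 hθ'0.le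
  have hMle : (M : ℝ) ≤ 3 * x ^ θ' := by
    have h1 : (⌊x ^ θ'⌋₊ : ℝ) ≤ x ^ θ' := Nat.floor_le (Real.rpow_nonneg hx0.le _)
    push_cast [hMdef]
    linarith
  set P : Finset ℕ := (Ioc M (2 * M)).filter Nat.Prime with hPdef
  set S : Finset ℕ := P.filter (fun p : ℕ => p ∉ Q) with hSdef
  have hSP : S ⊆ P := by rw [hSdef]; exact filter_subset _ _
  have hp2M : ∀ p ∈ S, (p : ℝ) ≤ 2 * M := fun p hp => by
    have := hSP hp; rw [hPdef, mem_filter, mem_Ioc] at this; exact_mod_cast this.1.2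
  have hSprop : ∀ p ∈ S, p.Prime ∧ (M : ℝ) < p ∧ (x / 2) ^ θ < (p : ℝ) ∧
      (p : ℝ) ≤ x ^ (θ + ν) := by
    intro p hp
    have hp' := hSP hp
    rw [hPdef, mem_filter, mem_Ioc] at hp'
    obtain ⟨⟨hMp, hp2⟩, hpr⟩ := hp'
    have hMp' : (M : ℝ) < p := by exact_mod_cast hMp
    have hp2M' : (p : ℝ) ≤ 2 * M := by exact_mod_cast hp2
    exact ⟨hpr, hMp', hMθ.trans hMp', by linarith⟩
  have hSQ : ∀ p ∈ S, p ∉ Q := fun p hp => by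
    have := hp; rw [hSdef, Finset.mem_filter] at this; exact this.2
  have hSκ : ∀ p ∈ S, (p : ℝ) ≤ x ^ κ := fun p hp => by linarith [hMle, e1', hp2M p hp]
  -- the columns over `S` are sub-columns of the hypothesis
  have hcolS : ∀ n : ℕ, ∑ p ∈ S.filter
      (fun p : ℕ => x / 2 < (p * n : ℝ) ∧ (p * n : ℝ) ≤ x), b (p * n) ≤ x ^ σ := by
    intro n
    refine le_trans (sum_le_sum_of_subset_of_nonneg ?_ (fun _ _ _ => hb0 _)) (hcol n)
    intro p hp
    rw [Finset.mem_filter] at hp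
    obtain ⟨hpS, hpn⟩ := hp
    obtain ⟨hpr, _, hpθ, _⟩ := hSprop p hpS
    rw [Finset.mem_filter, mem_Icc]
    exact ⟨⟨hpr.one_le, Nat.le_floor (hSκ p hpS)⟩, hpr, hpθ, hpn⟩
  have hmain := typeII_sparse_le_col (by linarith) hx1 (by linarith : (1 : ℝ) < M) S A hSprop
    hcov hb0 hcolS hII
  -- lower bounds
  have hL : Real.log x / Real.log M ≤ 2 * Real.log x := by
    have hlogM : Real.log 2 ≤ Real.log M := Real.log_le_log two_pos hM2r
    have hl2 := Real.log_two_gt_d9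
    rw [div_le_iff₀ (by linarith)]
    nlinarith
  have hcardP := hK M (by omega)
  have h2Mx : 2 * (M : ℝ) ≤ x := by linarith
  have hlog2M0 : 0 < Real.log (2 * M) := Real.log_pos (by linarith)
  have hlog2M : Real.log (2 * M) ≤ Real.log x := Real.log_le_log (by positivity) h2Mx
  have hlx0 : 0 < Real.log x := by linarith
  -- `#S ≥ M/(2K log 2M)`
  have hl3 : Real.log x ^ 2 * (2 * K * Real.log (2 * M)) ≤ M := by
    have e5' : 4 * K * (x ^ (θ' / 4) * x ^ (θ' / 4) * x ^ (θ' / 4)) ≤ x ^ (θ') := by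
      rw [← Real.rpow_add hx0, ← Real.rpow_add hx0]; exact e5
    exact sq_mul_le_of_cube_le hK0.le hlog2M0.le hlog2M hlogle2 e5' hMθ'.le
  have hcardS : (M : ℝ) / (2 * K * Real.log (2 * M)) ≤ S.card := by
    rw [hSdef, hPdef]
    exact div_le_card_filter_not_mem hK0 hlog2M0 hcardP hQ hl3
  have hsum : (S.card : ℝ) * (x / (8 * M)) ≤ ∑ p ∈ S, ∑ n ∈ (Icc 1 ⌊x⌋₊).filter
      (fun n : ℕ => x / 2 < (p * n : ℝ) ∧ (p * n : ℝ) ≤ x), b (p * n) := by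
    rw [← nsmul_eq_mul, ← sum_const]
    refine sum_le_sum fun p hp => ?_
    obtain ⟨hpr, _, hpθ, _⟩ := hSprop p hp
    have hp0 : (0 : ℝ) < p := by exact_mod_cast hpr.pos
    have : x / (8 * M) ≤ x / (4 * p) :=
      div_le_div_of_nonneg_left hx0.le (by positivity) (by linarith [hp2M p hp])
    exact this.trans (hbm p hpr (hSQ p hp) hpθ (hSκ p hp))
  -- the removed mass: `x^σ · #A · L ≤ 2 x^{max σ 0} x^{1−c} log x ≤ x/(64 K log x)`
  have hlogM0 : 0 ≤ Real.log M := Real.log_nonneg (by linarith)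
  have hAL : (A.card : ℝ) * (Real.log x / Real.log M) ≤ x ^ (1 - c) * (2 * Real.log x) :=
    mul_le_mul hA hL (div_nonneg hlx hlogM0) (Real.rpow_nonneg hx0.le _)
  have hALnn : (0 : ℝ) ≤ A.card * (Real.log x / Real.log M) :=
    mul_nonneg (Nat.cast_nonneg _) (div_nonneg hlx hlogM0)
  have hX : x ^ σ * (A.card * (Real.log x / Real.log M)) ≤
      x ^ (max σ 0) * (x ^ (1 - c) * (2 * Real.log x)) :=
    mul_le_mul (Real.rpow_le_rpow_of_exponent_le hx1 hsσ) hAL hALnn (Real.rpow_nonneg hx0.le _)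
  have hbadU : x ^ (max σ 0) * (x ^ (1 - c) * (2 * Real.log x)) ≤
      x / (8 * (4 * K) * Real.log x) / 2 := rpow_mul_log_le_div hx0 hK0 hlx0 hlogle e3
  have hM0r : (0 : ℝ) < M := by positivity
  obtain ⟨hTlow, h2T⟩ := div_log_le_card_mul_div hx0 hK0 hM0r hlx0 hlog2M0 hlog2M hcardS
  have hfin := div_log_rpow_lt (by positivity : 0 < 4 * K) (by linarith) e4'
  have hUpos : 0 < x / (8 * (4 * K) * Real.log x) := by positivity
  linarith

/-- **Corollary: the `(n, q) = 1` twist.**  For every modulus `0 < q ≤ x²` the exceptional set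
may be taken to be the prime divisors of `q`. [cite: FordMaynard2024PrimeSieves, §4.2] -/
theorem eventually_not_typeII_of_sparse_col_coprime {c θ ν B σ κ : ℝ} (hθ : 0 ≤ θ)
    (hθc : θ < c) (hc1 : c ≤ 1) (hσ : σ < c) (hν : 0 < ν) (hB : 1 < B) (hκ : θ < κ) :
    ∀ᶠ x : ℝ in atTop, ∀ (a b : ℕ → ℝ) (A : Finset ℕ) (q : ℕ), (A.card : ℝ) ≤ x ^ (1 - c) →
      (∀ v : ℕ, x / 2 < (v : ℝ) → (v : ℝ) ≤ x → a v ≠ 0 → v ∈ A) →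
      (∀ n, 0 ≤ b n) → 0 < q → (q : ℝ) ≤ x ^ 2 →
      (∀ n : ℕ, ∑ p ∈ (Icc 1 ⌊x ^ κ⌋₊).filter (fun p : ℕ => p.Prime ∧
          (x / 2) ^ θ < (p : ℝ) ∧ (x / 2 < (p * n : ℝ) ∧ (p * n : ℝ) ≤ x)), b (p * n)
        ≤ x ^ σ) →
      (∀ p : ℕ, p.Prime → ¬ p ∣ q → (x / 2) ^ θ < (p : ℝ) → (p : ℝ) ≤ x ^ κ →
        x / (4 * p) ≤ ∑ n ∈ (Icc 1 ⌊x⌋₊).filter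
          (fun n : ℕ => x / 2 < (p * n : ℝ) ∧ (p * n : ℝ) ≤ x), b (p * n)) →
      ¬ TypeII (fun n : ℕ => a n - b n) x θ ν B := by
  filter_upwards [eventually_not_typeII_of_sparse_col hθ hθc hc1 hσ hν hB hκ,
    eventually_ge_atTop (Real.exp 6)] with x hx hx6 a b A q hA hcov hb0 hq hqx hcol hbm
  refine hx a b A q.primeFactors hA hcov hb0 (card_primeFactors_le_log_sq hx6 hq hqx) hcol ?_
  intro p hpr hpQ
  exact hbm p hpr (fun hd => hpQ (Nat.mem_primeFactors.mpr ⟨hpr, hd, hq.ne'⟩))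

end Summit.Parity.BatemanHorn.Theorems

end
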